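import Mathlib.RepresentationTheory.Coinvariants
import Mathlib.RepresentationTheory.Subrepresentation
import Mathlib.RepresentationTheory.Intertwining
import Mathlib.MeasureTheory.Group.ModularCharacter
import Mathlib.GroupTheory.Complement
import Mathlib.Analysis.Real.Sqrt
import Mathlib.Analysis.Complex.Basic
import Mathlib.LinearAlgebra.Matrix.GeneralLinearGroup.Defs
import Mathlib.Topology.Instances.Matrix
import Literature.NumberTheory.Automorphic.SmoothInduction
import Literature.NumberTheory.Automorphic.SmoothRepresentation
import Literature.NumberTheory.Automorphic.MatrixCoefficients
import Literature.NumberTheory.GaloisRepresentations.LocalField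
import Literature.NumberTheory.DiophantineGeometry.GLHighestWeight
import HarnessLib

-- provenance: harness21/H21/H21/Prelude/AutomorphicL/JacquetModule.lean @ c206d2d (interim HEAD d8f2665); M5 mechanical rewrite
/-!
# Jacquet modules, modulus characters and normalised parabolic induction
(AutomorphicL trunk, item I6 = `G25:JacquetModule`; notion `parabolic_induction_jacquet`)

Let `G` be a (topological) group. A *parabolic triple* `t = (P, M, N)` in `G` consists of
subgroups `M, N ≤ P ≤ G` with `P` normalising `N` and `P = M ⋉ N` (`M ∩ N = 1`, `M N = P`).
For a representation `ρ` of `G` on a `k`-module `V` the **Jacquet module** `r_P ρ = ρ_N` is the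
space of `N`-coinvariants `V_N = V / ⟨ρ(n) v - v⟩` with the induced action of `M`
(Bernstein–Zelevinsky 1977, §1.8; Casselman 1995, §3.1). This file provides

* `Literature.ParabolicTriple G`, its Levi projection `proj : P →* M`;
* `Representation.jacquetModule ρ t : Representation k ↥t.M (V_N)` and its functoriality
  `Representation.jacquetMap`;
* the modulus character `Literature.deltaChar P : ↥P →* ℂˣ` (`= δ_P`, see the convention below), its
  square root `Literature.rootDeltaChar P`, and the sanity statement `Literature.NumberTheory.Automorphic.deltaChar_borel_gl_two` pinning
  the convention on the upper Borel subgroup of `GL₂(F)`;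
* normalised parabolic induction `Representation.normalizedInd t σ = Ind_P^G (σ ⊗ δ_P^{1/2})` and
  the normalised Jacquet functor `Representation.normalizedJacquet t ρ = ρ_N ⊗ δ_P^{-1/2}`
  (Bernstein–Zelevinsky 1977, §2.3; Casselman 1995, §3);
* `Literature.NumberTheory.Automorphic.IsLimitOfCompactOpen` (a group exhausted by its compact open subgroups),
  `Representation.IsCuspidalRep` (all proper Jacquet modules vanish), and
  `Literature.NumberTheory.Automorphic.ParabolicTriple.IwahoriDatum` (the hypotheses of Jacquet's lemma: Iwahori factorisation and
  a contracting element, Casselman 1995, Prop. 1.4.4);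
* theorems: smoothness of Jacquet modules (`isSmooth_jacquetModule`, proved), and with proofs
  deferred: exactness of the Jacquet functor (`jacquet_exact`, BZ 1976 Prop. 2.35) and
  admissibility (`isAdmissible_jacquetModule` = Jacquet's lemma, Casselman 1995 Thm. 3.3.1),
  both over fields of characteristic `0` (their proofs average over compact open subgroups), and
  Frobenius reciprocity for normalised induction (`frobenius_normalizedInd`, BZ 1977
  Prop. 1.9(b)), stated under BZ's standing assumption that `δ_P` is trivial on `N` (automatic
  when `N` is a union of compact subgroups, BZ 1977, 1.8). The Levi projection lemmas and
  `rootDeltaChar_sq` are proved.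

## Mathlib declarations used rather than redefined

`Representation.Coinvariants`, `Representation.Coinvariants.mk`, `Representation.Coinvariants.map`,
`Representation.toCoinvariants` (with `Coinvariants.le_comap_ker`; no hand-rolled kernel lemma),
`Subgroup.subgroupOf`, `Subgroup.inclusion`, `Subgroup.normal_subgroupOf_iff_le_normalizer`,
`Subgroup.IsComplement'`, `Subgroup.IsComplement'.QuotientMulEquiv`, `QuotientGroup.mk'`,
`Subgroup.subgroupOfEquivOfLe`, `MeasureTheory.Measure.modularCharacter`, `NNReal.sqrtHom`,
`Representation.IntertwiningMap` (and its `Module` structure), `Function.Exact`.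
From H21: `Representation.smoothIndRep` (I5), `Representation.twist`,
`Representation.IsSmooth`, `Representation.IsAdmissible` (G19),
`Literature.NumberTheory.GaloisRepresentations.IsNonarchimedeanLocalField.normAbs` (GalRep C1), `Literature.NumberTheory.DiophantineGeometry.borelSubgroup` (C7; the
upper Borel of `GL₂` is not redefined here).

## Modulus convention (outline D4, review 3)

Mathlib's `modularCharacter : G →* ℝ≥0` is characterised by `map (· * g) μ = Δ(g) • μ` for a
left Haar measure `μ`, i.e. `μ (A g) = Δ(g)⁻¹ μ(A)`. For the upper Borel `B = T U` of `GL₂(F)`,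
`F` non-archimedean local, this gives `Δ(diag(a, d) u) = |a / d|_F`, which is the classical
modulus `δ_B` of Bernstein–Zelevinsky (1977, 1.7) and Casselman (1995, §1.5, §3.1). Hence
**`deltaChar P := modularCharacter` of `↥P` (coerced into `ℂˣ`) is `δ_P`**; the sorried sanity
theorem `deltaChar_borel_gl_two` pins this. No `Subgroup.modulus` wrapper is introduced.

## Design notes

* `ParabolicTriple` is abstract (any group); honest parabolic subgroups of `GL_n` are item I7.
  Normality of `N` in `P` is the *lemma* `ParabolicTriple.normal_subgroupOf` (not a global
  instance); definitions needing it use `haveI`.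
* The carrier of the Jacquet module is `(t.restrict ρ).Coinvariants` where
  `t.restrict ρ = (ρ.comp t.P.subtype).comp (t.N.subgroupOf t.P).subtype` is an `abbrev`, so
  that Mathlib's `toCoinvariants (ρ.comp t.P.subtype) (t.N.subgroupOf t.P)` has literally this
  carrier.
* Jacquet's lemma is false for arbitrary "parabolic triples" in arbitrary totally disconnected
  groups (e.g. `t = (U, 1, U)` in `SL₂(F)`), so `isAdmissible_jacquetModule` takes the standard
  hypotheses of its proof, bundled as `ParabolicTriple.IwahoriDatum` (Casselman 1995,
  Prop. 1.4.4 and the proof of Thm. 3.3.3): a basis of compact open subgroups `K` with Iwahori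
  factorisation `K = (K ∩ N̄)(K ∩ M)(K ∩ N)` and an element `a` centralising `M` whose inverse
  powers contract `K ∩ N̄` to `1`. For reductive `p`-adic groups such data exist (loc. cit.).
* `LocallyCompactSpace ↥P` (needed for `modularCharacter`) is an instance hypothesis; it holds
  for closed `P` in locally compact `G`.
* Namespaces: group-theoretic and measure-theoretic notions live in `namespace Literature`;
  representation-theoretic constructions are deliberate dot-notation extensions in
  `namespace Representation` (as in items I5 and G19).

## References

* I. N. Bernstein, A. V. Zelevinsky, *Representations of the group `GL(n, F)` where `F` is a
  non-archimedean local field*, Russian Math. Surveys 31 (1976), §§2.30–2.35, §3.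
* I. N. Bernstein, A. V. Zelevinsky, *Induced representations of reductive `p`-adic groups I*,
  Ann. Sci. ÉNS 10 (1977), §§1–2.
* W. Casselman, *Introduction to the theory of admissible representations of `p`-adic reductive
  groups* (1995 notes), §1.4, §1.5, §3.
-/

open scoped NNReal Pointwise
open MeasureTheory

namespace Literature.NumberTheory.Automorphic

/-! ### Parabolic triples -/

/-- A **parabolic triple** `(P, M, N)` in a group `G`: subgroups `M, N ≤ P` such that `P`
normalises `N` and `P` is the semidirect product `M ⋉ N`, i.e. `M ∩ N = 1` and `M N = P`
(expressed by `Subgroup.IsComplement'` inside `P`). The model is a parabolic subgroup `P` of a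
reductive group with Levi factor `M` and unipotent radical `N`
(Bernstein–Zelevinsky 1977, §1.8; Casselman 1995, §1.4). [cite: BernsteinZelevinsky1977, §1.8] -/
structure ParabolicTriple (G : Type*) [Group G] where
  /-- The parabolic subgroup `P`. -/
  P : Subgroup G
  /-- The Levi subgroup `M ≤ P`. -/
  M : Subgroup G
  /-- The "unipotent radical" `N ≤ P`, normal in `P`. -/
  N : Subgroup G
  /-- `M ≤ P`. -/
  M_le : M ≤ P
  /-- `N ≤ P`. -/
  N_le : N ≤ P
  /-- `P` normalises `N`. -/
  le_normalizer : P ≤ Subgroup.normalizer (N : Set G)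
  /-- `P = M ⋉ N`: `M` and `N` are complementary subgroups of `P`. -/
  isComplement' : (M.subgroupOf P).IsComplement' (N.subgroupOf P)

namespace ParabolicTriple

variable {G : Type*} [Group G] (t : ParabolicTriple G)

/-- `N` is a normal subgroup of `P` (Mathlib `Subgroup.normal_subgroupOf_iff_le_normalizer`).
(Bernstein–Zelevinsky 1977, §1.8.) [cite: BernsteinZelevinsky1977, §1.8] -/
theorem normal_subgroupOf : (t.N.subgroupOf t.P).Normal :=
  (Subgroup.normal_subgroupOf_iff_le_normalizer t.N_le).2 t.le_normalizer

/-- The **Levi projection** `P →* M`, `m n ↦ m`: the composite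
`P → P / N ≃ M` (Mathlib `Subgroup.IsComplement'.QuotientMulEquiv`) followed by the
identification `M.subgroupOf P ≃* M`. (Bernstein–Zelevinsky 1977, §1.8; Casselman 1995, §3.1.) [cite: BernsteinZelevinsky1977, §1.8] -/
noncomputable def proj : t.P →* t.M :=
  haveI := t.normal_subgroupOf
  (Subgroup.subgroupOfEquivOfLe t.M_le).toMonoidHom.comp
    (t.isComplement'.QuotientMulEquiv.toMonoidHom.comp (QuotientGroup.mk' (t.N.subgroupOf t.P)))

/-- `M ∩ N = 1`: an element of both `M` and `N` is trivial. [folklore] -/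
theorem eq_one_of_mem_of_mem {g : G} (hM : g ∈ t.M) (hN : g ∈ t.N) : g = 1 := by
  have h := Subgroup.disjoint_def.1 t.isComplement'.disjoint (x := ⟨g, t.M_le hM⟩)
    (Subgroup.mem_subgroupOf.2 hM) (Subgroup.mem_subgroupOf.2 hN)
  exact congrArg Subtype.val h

/-- Defining property of the Levi projection: `(proj p)⁻¹ p ∈ N`, i.e. `p = proj p · n`. [folklore] -/
theorem proj_inv_mul_mem (p : t.P) : (t.proj p : G)⁻¹ * p ∈ t.N := by
  haveI := t.normal_subgroupOf
  have h := Subgroup.IsComplement.quotientGroupMk_leftQuotientEquiv t.isComplement'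
    (QuotientGroup.mk p : t.P ⧸ t.N.subgroupOf t.P)
  have h' : ((Subgroup.IsComplement.leftQuotientEquiv t.isComplement'
      (QuotientGroup.mk p : t.P ⧸ t.N.subgroupOf t.P) : t.P))⁻¹ * p ∈ t.N.subgroupOf t.P :=
    QuotientGroup.eq.1 h
  exact Subgroup.mem_subgroupOf.1 h'

/-- The Levi projection is the identity on `M`. (Bernstein–Zelevinsky 1977, §1.8.) [cite: BernsteinZelevinsky1977, §1.8] -/
theorem proj_apply_of_mem_M (p : t.P) (hp : (p : G) ∈ t.M) : (t.proj p : G) = p := by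
  have h1 : (t.proj p : G)⁻¹ * p ∈ t.M := t.M.mul_mem (t.M.inv_mem (t.proj p).2) hp
  have h2 := t.eq_one_of_mem_of_mem h1 (t.proj_inv_mul_mem p)
  exact (inv_mul_eq_one.1 h2)

/-- The Levi projection kills `N`. (Bernstein–Zelevinsky 1977, §1.8.) [cite: BernsteinZelevinsky1977, §1.8] -/
theorem proj_apply_of_mem_N (p : t.P) (hp : (p : G) ∈ t.N) : t.proj p = 1 := by
  have h1 : (t.proj p : G) ∈ t.N := by
    have := t.N.mul_mem (t.proj_inv_mul_mem p) (t.N.inv_mem hp)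
    simpa using t.N.inv_mem (by simpa [mul_assoc] using this)
  exact Subtype.ext (t.eq_one_of_mem_of_mem (t.proj p).2 h1)

/-- The restriction `ρ|_N` of a representation of `G` to `N`, viewed as the subgroup
`N.subgroupOf P` of `P` (an `abbrev`; its coinvariants are the carrier of the Jacquet module).
(Bernstein–Zelevinsky 1977, §1.8.) [cite: BernsteinZelevinsky1977, §1.8] -/
abbrev restrict {k V : Type*} [CommRing k] [AddCommGroup V] [Module k V]
    (ρ : Representation k G V) : Representation k ↥(t.N.subgroupOf t.P) V :=
  (ρ.comp t.P.subtype).comp (t.N.subgroupOf t.P).subtype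

end ParabolicTriple

end Literature.NumberTheory.Automorphic

/-! ### Jacquet modules -/

namespace Representation

open Literature.NumberTheory.Automorphic Literature.NumberTheory.GaloisRepresentations

section Jacquet

variable {k G V W : Type*} [CommRing k] [Group G] [AddCommGroup V] [Module k V]
  [AddCommGroup W] [Module k W]

/-- The **Jacquet module** `r_P ρ = ρ_N` of a representation `ρ` of `G` with respect to a
parabolic triple `t = (P, M, N)`: the `N`-coinvariants `V_N = V / span {ρ n v - v}` with the
action of `M ≤ P` induced from Mathlib's `Representation.toCoinvariants (ρ.comp P.subtype)
(N.subgroupOf P)` along `Subgroup.inclusion : M → P`.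
(Bernstein–Zelevinsky 1977, §1.8; Casselman 1995, §3.1.) [cite: BernsteinZelevinsky1977, §1.8] -/
noncomputable def jacquetModule (ρ : Representation k G V) (t : ParabolicTriple G) :
    Representation k t.M (t.restrict ρ).Coinvariants :=
  haveI := t.normal_subgroupOf
  (Representation.toCoinvariants (ρ.comp t.P.subtype) (t.N.subgroupOf t.P)).comp
    (Subgroup.inclusion t.M_le)

/-- The action on the Jacquet module: `m • [v] = [ρ m v]`. [folklore] -/
@[simp] lemma jacquetModule_mk (ρ : Representation k G V) (t : ParabolicTriple G) (m : t.M)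
    (v : V) :
    ρ.jacquetModule t m (Coinvariants.mk (t.restrict ρ) v) =
      Coinvariants.mk (t.restrict ρ) (ρ m v) :=
  rfl

/-- **Functoriality of the Jacquet module**: an intertwining map `f : ρ → ρ'` of
`G`-representations induces an `M`-intertwining map `r_P ρ → r_P ρ'`, `[v] ↦ [f v]`
(Mathlib `Coinvariants.map`). (Bernstein–Zelevinsky 1977, §1.8; Casselman 1995, §3.1.) [cite: BernsteinZelevinsky1977, §1.8] -/
noncomputable def jacquetMap {ρ : Representation k G V} {ρ' : Representation k G W}
    (t : ParabolicTriple G) (f : ρ.IntertwiningMap ρ') :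
    (ρ.jacquetModule t).IntertwiningMap (ρ'.jacquetModule t) where
  toLinearMap := Coinvariants.map (t.restrict ρ) (t.restrict ρ')
    ⟨f.toLinearMap, fun n => f.isIntertwining' _⟩
  isIntertwining' m := by
    refine Coinvariants.hom_ext ?_
    ext v
    simp [f.isIntertwining]

/-- `jacquetMap t f [v] = [f v]`. [folklore] -/
@[simp] lemma jacquetMap_mk {ρ : Representation k G V} {ρ' : Representation k G W}
    (t : ParabolicTriple G) (f : ρ.IntertwiningMap ρ') (v : V) :
    jacquetMap t f (Coinvariants.mk (t.restrict ρ) v) = Coinvariants.mk (t.restrict ρ') (f v) :=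
  rfl

/-- A representation `ρ` of `G` is **cuspidal** (quasi-cuspidal in BZ) with respect to a family
`S` of parabolic triples if all its proper Jacquet modules vanish: `r_P ρ = 0` for every
`t = (P, M, N) ∈ S` with `P ≠ G`.
(Bernstein–Zelevinsky 1977, §2.4; Casselman 1995, §5.) [cite: BernsteinZelevinsky1977, §2.4] -/
def IsCuspidalRep (ρ : Representation k G V) (S : Set (ParabolicTriple G)) : Prop :=
  ∀ t ∈ S, t.P ≠ ⊤ → Subsingleton (t.restrict ρ).Coinvariants

end Jacquet

end Representation

namespace Literature.NumberTheory.Automorphic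

/-! ### Topological conditions -/

/-- A topological group `H` is the **limit (union) of its compact open subgroups** if every
compact subset of `H` is contained in a compact open subgroup. Unipotent radicals of parabolic
subgroups of reductive `p`-adic groups have this property, which makes the coinvariant functor
exact (Bernstein–Zelevinsky 1976, §1.7 and Prop. 2.35). [cite: BernsteinZelevinsky1976, §1.7 and Prop. 2.35] -/
def IsLimitOfCompactOpen (H : Type*) [Group H] [TopologicalSpace H] : Prop :=
  ∀ C : Set H, IsCompact C →
    ∃ K : Subgroup H, IsOpen (K : Set H) ∧ IsCompact (K : Set H) ∧ C ⊆ K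

namespace ParabolicTriple

variable {G : Type*} [Group G] [TopologicalSpace G]

/-- An **Iwahori datum** for a parabolic triple `t = (P, M, N)` in a topological group `G`: the
hypotheses under which Jacquet's lemma is proved (Casselman 1995, Prop. 1.4.4 and the proof of
Thm. 3.3.3; Bernstein–Zelevinsky 1976, §3.15). It consists of an "opposite radical" `N̄`, an
element `a ∈ M` commuting with `M`, and a neighbourhood basis of `1` of compact open subgroups
`K n` admitting the *Iwahori factorisation* `K = (K ∩ N̄) (K ∩ M) (K ∩ N)`, such that the
`a⁻¹`-power conjugates of `K n ∩ N̄` shrink to `1` (only the fields consumed by Casselman's proof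
of Jacquet's lemma are recorded). For a parabolic subgroup of a reductive `p`-adic group such data exist
(Casselman 1995, Prop. 1.4.4, Lemma 1.4.3). [cite: Casselman1995, Prop. 1.4.4 and the proof of Thm. 3.3.3] -/
structure IwahoriDatum (t : ParabolicTriple G) where
  /-- The opposite "unipotent radical" `N̄`. -/
  Nbar : Subgroup G
  /-- The contracting element `a ∈ M`. -/
  a : G
  /-- `a ∈ M`. -/
  a_mem : a ∈ t.M
  /-- `a` commutes with `M` (in practice `a` lies in the split centre of `M`). -/
  a_comm : ∀ m ∈ t.M, m * a = a * m
  /-- A sequence of compact open subgroups forming a neighbourhood basis of `1`. -/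
  K : ℕ → Subgroup G
  /-- Each `K n` is open. -/
  isOpen_K : ∀ n, IsOpen (K n : Set G)
  /-- Each `K n` is compact. -/
  isCompact_K : ∀ n, IsCompact (K n : Set G)
  /-- The `K n` form a neighbourhood basis of `1`. -/
  hasBasis_K : ∀ U ∈ nhds (1 : G), ∃ n, (K n : Set G) ⊆ U
  /-- Iwahori factorisation `K = (K ∩ N̄) (K ∩ M) (K ∩ N)`, as an equality of sets (uniqueness of
  the decomposition is not recorded: the set-theoretic factorisation suffices for Jacquet's
  lemma). -/
  factorization : ∀ n, (K n : Set G) =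
    ((K n ⊓ Nbar : Subgroup G) : Set G) * ((K n ⊓ t.M : Subgroup G) : Set G) *
      ((K n ⊓ t.N : Subgroup G) : Set G)
  /-- The `a⁻¹`-conjugates of `K n ∩ N̄` become arbitrarily small. -/
  exists_conj_inf_Nbar_le : ∀ n j, ∃ i : ℕ, ConjAct.toConjAct (a ^ i)⁻¹ • (K n ⊓ Nbar) ≤ K j

end ParabolicTriple

/-! ### Modulus characters -/

section Modulus

variable {G : Type*} [Group G] [TopologicalSpace G] [IsTopologicalGroup G]
  (P : Subgroup G) [LocallyCompactSpace P]

/-- The **modulus character** `δ_P : P →* ℂˣ` of a (closed) subgroup `P` of a topological group: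
Mathlib's `MeasureTheory.Measure.modularCharacter` of the locally compact group `↥P`, coerced
along `ℝ≥0 → ℝ → ℂ`. With Mathlib's convention `map (· * g) μ = Δ(g) • μ` this **is** the
classical `δ_P` (`δ_B (diag(a,d) u) = |a/d|` on the Borel of `GL₂`; see
`deltaChar_borel_gl_two`). (Bernstein–Zelevinsky 1977, 1.7; Casselman 1995, §1.5.) [cite: BernsteinZelevinsky1977, 1.7] -/
noncomputable def deltaChar : P →* ℂˣ :=
  (Units.map ((algebraMap ℝ ℂ).toMonoidHom.comp NNReal.toRealHom.toMonoidHom)).comp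
    (Measure.modularCharacter (G := P)).toHomUnits

/-- `δ_P p = Δ_P(p)` as a complex number. [folklore] -/
@[simp] lemma deltaChar_apply (p : P) :
    ((deltaChar P p : ℂˣ) : ℂ) = ((Measure.modularCharacter p : ℝ≥0) : ℝ) := rfl

/-- The **square root of the modulus character** `δ_P^{1/2} : P →* ℂˣ`, built from the monoid
hom `NNReal.sqrtHom`; used to normalise parabolic induction and Jacquet modules.
(Bernstein–Zelevinsky 1977, 1.7 and §2.3; Casselman 1995, §3.) [cite: BernsteinZelevinsky1977, 1.7 and §2.3] -/
noncomputable def rootDeltaChar : P →* ℂˣ :=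
  (Units.map ((algebraMap ℝ ℂ).toMonoidHom.comp
    (NNReal.toRealHom.toMonoidHom.comp (NNReal.sqrtHom : ℝ≥0 →*₀ ℝ≥0).toMonoidHom))).comp
    (Measure.modularCharacter (G := P)).toHomUnits

/-- `δ_P^{1/2} p = √Δ_P(p)` as a complex number. [folklore] -/
@[simp] lemma rootDeltaChar_apply (p : P) :
    ((rootDeltaChar P p : ℂˣ) : ℂ) = ((NNReal.sqrt (Measure.modularCharacter p) : ℝ≥0) : ℝ) :=
  rfl

/-- `(δ_P^{1/2})² = δ_P`. [folklore] -/
theorem rootDeltaChar_sq (p : P) : rootDeltaChar P p ^ 2 = deltaChar P p := by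
  ext
  simp only [Units.val_pow_eq_pow_val, rootDeltaChar_apply, deltaChar_apply]
  rw [← Complex.ofReal_pow, ← NNReal.coe_pow, NNReal.sq_sqrt]

/-- If `δ_P p = 1` then `δ_P^{1/2} p = 1` (used to consume the hypothesis `hδ` of
`frobenius_normalizedInd`). [folklore] -/
lemma rootDeltaChar_eq_one_of_deltaChar_eq_one {p : P} (h : deltaChar P p = 1) :
    rootDeltaChar P p = 1 := by
  have h' : Measure.modularCharacter p = 1 := by
    have := congrArg (fun u : ℂˣ => (u : ℂ)) h
    simp only [deltaChar_apply, Units.val_one] at this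
    exact_mod_cast this
  ext
  simp [rootDeltaChar_apply, h']

end Modulus

/-! ### The convention check on `GL₂` -/

section GLTwo

variable (F : Type*) [Field F] [ValuativeRel F] [TopologicalSpace F]
  [IsNonarchimedeanLocalField F]

/-- **Convention check** (outline D4, review 3): on the upper Borel `B` of `GL₂(F)`
(`Literature.CplxAlg.borelSubgroup (Fin 2) F`, item C7), `F` a non-archimedean local field, the
modulus character `deltaChar B` (Mathlib's `modularCharacter`) is `p ↦ |p₀₀ / p₁₁|_F`, the
classical `δ_B` (Bernstein–Zelevinsky 1977, 1.7; Bushnell–Henniart 2006, §7.6).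
`LocallyCompactSpace ↥B` holds since `B` is closed in the locally compact group `GL₂(F)`; it is
taken as an instance hypothesis. [cite: BernsteinZelevinsky1977, 1.7] -/
def deltaChar_borel_gl_two : Prop :=
  ∀ [LocallyCompactSpace (DiophantineGeometry.borelSubgroup (Fin 2) F)] (p : DiophantineGeometry.borelSubgroup (Fin 2) F),
    ((deltaChar (DiophantineGeometry.borelSubgroup (Fin 2) F) p : ℂˣ) : ℂ) =
      ((GaloisRepresentations.IsNonarchimedeanLocalField.normAbs F
        (((p : GL (Fin 2) F) : Matrix (Fin 2) (Fin 2) F) 0 0 /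
          ((p : GL (Fin 2) F) : Matrix (Fin 2) (Fin 2) F) 1 1) : ℝ) : ℂ)

end GLTwo

end Literature.NumberTheory.Automorphic

/-! ### Normalised induction and Jacquet functor; the main theorems -/

namespace Representation

open Literature.NumberTheory.Automorphic Literature.NumberTheory.GaloisRepresentations

section Normalized

variable {G : Type*} [Group G] [TopologicalSpace G] [IsTopologicalGroup G]
  (t : ParabolicTriple G) [LocallyCompactSpace t.P]

/-- **Normalised parabolic induction** `i_P^G σ = Ind_P^G (σ ∘ proj ⊗ δ_P^{1/2})`: inflate the
representation `σ` of `M` to `P` along the Levi projection, twist by `δ_P^{1/2}`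
(`Representation.twist`, G19) and apply smooth induction (`Representation.smoothIndRep`, I5).
(Bernstein–Zelevinsky 1977, §2.3; Casselman 1995, §3.1.) [cite: BernsteinZelevinsky1977, §2.3] -/
noncomputable def normalizedInd {W : Type*} [AddCommGroup W] [Module ℂ W]
    (σ : Representation ℂ t.M W) :
    Representation ℂ G
      (SmoothInd t.P (Representation.twist (σ.comp t.proj) (rootDeltaChar t.P))) :=
  smoothIndRep t.P (Representation.twist (σ.comp t.proj) (rootDeltaChar t.P))

/-- The **normalised Jacquet module** `r_P^G ρ = ρ_N ⊗ δ_P^{-1/2}` (restricted to `M`), the left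
adjoint of `normalizedInd`. (Bernstein–Zelevinsky 1977, §2.3; Casselman 1995, §3.1.) [cite: BernsteinZelevinsky1977, §2.3] -/
noncomputable def normalizedJacquet {V : Type*} [AddCommGroup V] [Module ℂ V]
    (ρ : Representation ℂ G V) : Representation ℂ t.M (t.restrict ρ).Coinvariants :=
  (ρ.jacquetModule t).twist ((rootDeltaChar t.P)⁻¹.comp (Subgroup.inclusion t.M_le))

/-- Unfolding lemma for `normalizedJacquet`: `m • [v] = δ_P(m)^{-1/2} [ρ m v]`. [folklore] -/
@[simp] lemma normalizedJacquet_mk {V : Type*} [AddCommGroup V] [Module ℂ V]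
    (ρ : Representation ℂ G V) (m : t.M) (v : V) :
    ρ.normalizedJacquet t m (Coinvariants.mk (t.restrict ρ) v) =
      (((rootDeltaChar t.P (Subgroup.inclusion t.M_le m))⁻¹ : ℂˣ) : ℂ) •
        Coinvariants.mk (t.restrict ρ) (ρ m v) :=
  rfl

end Normalized

section Theorems

variable {k G V : Type*} [CommRing k] [Group G] [TopologicalSpace G]
  [AddCommGroup V] [Module k V]

/-- The Jacquet module of a smooth representation is smooth (the stabiliser of `[v]` contains
`M ∩ Stab(v)`; proved here). (Bernstein–Zelevinsky 1977, §1.8; Casselman 1995, §3.1.) [cite: BernsteinZelevinsky1977, §1.8] -/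
theorem isSmooth_jacquetModule [IsTopologicalGroup G] (ρ : Representation k G V)
    (t : ParabolicTriple G) (hρ : ρ.IsSmooth) : (ρ.jacquetModule t).IsSmooth := by
  intro x
  obtain ⟨v, rfl⟩ := Coinvariants.mk_surjective (t.restrict ρ) x
  refine (ρ.jacquetModule t).isSmoothVector_of_le
    (K := (ρ.stabilizerSubgroup v).comap t.M.subtype)
    ((hρ v).preimage continuous_subtype_val) fun m hm => ?_
  rw [Subgroup.mem_comap, mem_stabilizerSubgroup] at hm
  rw [mem_stabilizerSubgroup, jacquetModule_mk]
  exact congrArg _ hm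

end Theorems

section CharZero

/-! The next two theorems are characteristic-`0` statements: their proofs average over compact
open subgroups of `N` (resp. of `K ∩ M`, `K ∩ N`), which requires the (pro-`p`) indices to be
invertible in `k`. Over `k = 𝔽_p` exactness already fails for `G = N = ℤ_p` acting unipotently on
`k²`.

**Warning (2026-08-15): both named facts of this section are mis-stated as Lean constants.** A
`def … : Prop` only absorbs the section variables its body *uses*; neither body below mentions
`[CharZero k]` or `[IsTopologicalGroup G]`, so Lean dropped both instances and the registered
constants `Representation.jacquet_exact` and `Representation.isAdmissible_jacquetModule` quantify
over fields of *every* characteristic (and arbitrary topologies on `G`). Both constants are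
**false** as registered — `Representation.not_jacquet_exact` (file `JacquetExactCounterexample`)
and `Representation.not_isAdmissible_jacquetModule` (file `JacquetLemmaCounterexample`), over
`k = 𝔽₂`, `G = ∏_ℕ ℤ/2ℤ` — and must not be taken as hypotheses. The intended statements are the
fully closed, **proved** facts `Representation.jacquet_exact_of_charZero` (file
`JacquetModuleExactCorrected`, proof in `JacquetModuleExactProofs`) and
`Representation.isAdmissible_jacquetModule_of_charZero` (file `JacquetLemma`); use those (or the
theorems `Representation.jacquet_exact_holds`, `Representation.IsAdmissible.jacquetModule`). The
two `def`s are kept verbatim below because the ledger and the refutations refer to them. -/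

variable {k G V : Type*} [Field k] [CharZero k] [Group G] [TopologicalSpace G]
  [IsTopologicalGroup G] [AddCommGroup V] [Module k V]

/-- **Exactness of the Jacquet functor** (for `k` a field of characteristic `0`): if `N` is the
union of its compact open subgroups and `G` is a topological group (both theorems of this
section need `[IsTopologicalGroup G]`: open subgroups of a compact open `N₀ ≤ N` must have finite
index), then `ρ ↦ r_P ρ` is exact on smooth representations: for a
short exact sequence `0 → ρ₁ → ρ₂ → ρ₃ → 0` of smooth `G`-representations,
`0 → r_P ρ₁ → r_P ρ₂ → r_P ρ₃ → 0` is exact. (Bernstein–Zelevinsky 1976, Prop. 2.35;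
Bernstein–Zelevinsky 1977, Prop. 1.9(a); Casselman 1995, Prop. 3.2.3, p. 34 of the draft of
1 May 1995 — the locator "Prop. 3.1.4" recorded earlier was wrong.)

**Mis-stated constant** (see the warning opening this section): as registered this `def` lacks
`[CharZero k] [IsTopologicalGroup G]` and is false (`Representation.not_jacquet_exact`); the
intended statement is the proved closed fact `Representation.jacquet_exact_of_charZero`
(`JacquetModuleExactCorrected`), and `Representation.jacquet_exact_holds`
(`JacquetModuleExactProofs`) proves the present statement under the two missing instances.
[cite: BernsteinZelevinsky1976, Prop. 2.35] -/
def jacquet_exact : Prop :=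
  ∀ {V₁ V₂ V₃ : Type*} [AddCommGroup V₁] [Module k V₁] [AddCommGroup V₂] [Module k V₂] [AddCommGroup V₃] [Module k V₃] {ρ₁ : Representation k G V₁} {ρ₂ : Representation k G V₂} {ρ₃ : Representation k G V₃} (t : ParabolicTriple G) (hN : IsLimitOfCompactOpen t.N) (h₁ : ρ₁.IsSmooth) (h₂ : ρ₂.IsSmooth) (h₃ : ρ₃.IsSmooth) (f : ρ₁.IntertwiningMap ρ₂) (g : ρ₂.IntertwiningMap ρ₃) (hf : Function.Injective f) (hfg : Function.Exact f g) (hg : Function.Surjective g),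
    Function.Injective (jacquetMap t f) ∧ Function.Exact (jacquetMap t f) (jacquetMap t g) ∧
      Function.Surjective (jacquetMap t g)

/-- **Jacquet's lemma** (for `k` a field of characteristic `0`): if `t = (P, M, N)` admits an
Iwahori datum (Iwahori factorisation and a contracting element, as for parabolic subgroups of
reductive `p`-adic groups), then the Jacquet module of an admissible representation is
admissible; more precisely `V^{K} → (V_N)^{K ∩ M}` is surjective for every `K` of the datum.
(Casselman 1995, Thm. 3.3.1 and Thm. 3.3.3, pp. 35–36 of the draft of 1 May 1995;
Bernstein–Zelevinsky 1977, Prop. 2.3(e).)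

**Mis-stated constant** (see the warning opening this section): as registered this `def` lacks
`[CharZero k] [IsTopologicalGroup G]` and is false
(`Representation.not_isAdmissible_jacquetModule`, file `JacquetLemmaCounterexample`); the intended
statement is the proved closed fact `Representation.isAdmissible_jacquetModule_of_charZero` (file
`JacquetLemma`, following Casselman's proof of Thm. 3.3.3), with the dot-notation form
`Representation.IsAdmissible.jacquetModule`. [cite: Casselman1995, Thm. 3.3.1 and Thm. 3.3.3] -/
def isAdmissible_jacquetModule : Prop :=
  ∀ (ρ : Representation k G V) (t : ParabolicTriple G) (𝓘 : t.IwahoriDatum) (hρ : ρ.IsAdmissible),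
    (ρ.jacquetModule t).IsAdmissible

end CharZero

section Frobenius

variable {G : Type*} [Group G] [TopologicalSpace G] [IsTopologicalGroup G]

/-- **Frobenius reciprocity for normalised induction**: let `t = (P, M, N)` be a parabolic
triple whose modulus character `δ_P` is trivial on `N` (hypothesis `hδ`; this is
Bernstein–Zelevinsky's standing assumption, 1977, 1.8–1.9, automatic when `N` is a union of
compact subgroups, e.g. a unipotent radical, and it is needed: `N` must act trivially on the
twist `δ_P^{1/2}` for `Hom_P (π, σ ∘ proj ⊗ δ_P^{1/2}) = Hom_M (π_N, σ ⊗ δ_P^{1/2}|_M)`). Then for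
a smooth representation `π` of `G` and any representation `σ` of `M`,
`Hom_G (π, i_P^G σ) ≃ₗ[ℂ] Hom_M (r_P^G π, σ)`
(the twists by `δ_P^{± 1/2}` on the two sides match:
`Hom_M (π_N, σ ⊗ δ^{1/2}) ≅ Hom_M (π_N ⊗ δ^{-1/2}, σ)`).
(Bernstein–Zelevinsky 1977, Prop. 1.9(b); Casselman 1995, Thm. 3.2.4.) [cite: BernsteinZelevinsky1977, Prop. 1.9(b] -/
def frobenius_normalizedInd : Prop :=
  ∀ {V W : Type*} [AddCommGroup V] [Module ℂ V] [AddCommGroup W] [Module ℂ W] (t : ParabolicTriple G) [LocallyCompactSpace t.P] (hδ : ∀ (n : G) (hn : n ∈ t.N), deltaChar t.P ⟨n, t.N_le hn⟩ = 1) (π : Representation ℂ G V) (σ : Representation ℂ t.M W) (hπ : π.IsSmooth),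
    Nonempty (π.IntertwiningMap (Representation.normalizedInd t σ) ≃ₗ[ℂ]
      (π.normalizedJacquet t).IntertwiningMap σ)

end Frobenius

end Representation
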